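import Summits.ABC.ABC.Statement
import Literature.StrongHypotheses.ABC.NumberFieldABCRat
import Literature.NumberTheory.DiophantineGeometry.NConjectureThreeIffAbc
import Literature.NumberTheory.EllipticCurves.DegreeConjectureAbc

/-!
# abc-iut F6 (D-0079 L-F, FACT rows F-1914 / F-1915): the two PRINTED bridges of the summit's Strong-Hypothesis
# registry are PROVABLE AS TYPED — kernel witnesses `NConjectureAll → ABC` and `NumberFieldABCConjecture → ABC`

PROOF-ONLY (two theorems; no `def`, no new named fact). The registry file `Summits/ABC/StrongHypotheses.lean` (D-0034)
carries two PRINTED bridges as named facts, `Summit.ABC.StrongHypotheses.NConjectureAllImpliesABC := NConjectureAll → ABC`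
(FACT-LIST F-1914) and `….NumberFieldABCConjectureImpliesABC := NumberFieldABCConjecture → ABC` (F-1915), with proof plans in
their docstrings. Both are ONE-LINE compositions of theorems ALREADY LANDED in `Literature/`:
* F-1915 ⟸ `Literature.StrongHypotheses.ABC.NumberFieldABCConjecture.abc_rat` (`Literature/StrongHypotheses/ABC/NumberFieldABCRat.lean`:
  the case `K = ℚ` — `H_ℚ(a:b:c) = c`, `N_ℚ(a,b,c) ≤ rad(abc)`) and the unfolding `ABC_iff`
  [cite: GranvilleStark2000, §1 (opening sentence) with eq. (1)];
* F-1914 ⟸ `Literature.NumberTheory.DiophantineGeometry.abcLe_of_nConjecture_three` (`…/NConjectureThreeIffAbc.lean`: the case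
  `n = 3`, exponent `2·3 − 5 = 1`, at `NConjectureAll 3 le_rfl`) and the `≤ ⟹ <` glue `abcLt_of_abcLe`
  (`…/EllipticCurves/DegreeConjectureAbc.lean`, `C ↦ max C 0 + 1`) [cite: BrowkinBrzezinski1994, §1 (n = 3 is the abc-conjecture)].
The theorems below have EXACTLY the bodies of the two registry defs as their types (`NConjectureAll → ABC`,
`NumberFieldABCConjecture → ABC`), so the registry's `…_holds` / bridge-form decls are `:=` these terms; they live here, in the
abc-iut cell topic, because no proposable target may import the registry file itself (gate `lint.import`) and the route-directed
`Summits/ABC/ABC/Theorems/` needs a statement item the F6 rows do not carry — the registry owner can alias them in two lines.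
abc-iut cell, sub-cell F6, holder abc-iut-w5-d223 gen 4 (L6-lead §F 13:36:48Z: «w5-d223 ×2 … the two StrongHypotheses rows»).
HONEST FRAMING: implications «stronger OPEN conjecture ⇒ abc»; NOTHING is asserted about abc itself; nothing here bears on
[IUTchIII] Cor. 3.12; no side taken.
-/

namespace Summit.ABC.IUTFork.F6

open Literature.NumberTheory.DiophantineGeometry
open Literature.StrongHypotheses.ABC

/-- **F-1915: abc over every number field ⟹ abc** — the body of the registry's printed bridge
`Summit.ABC.StrongHypotheses.NumberFieldABCConjectureImpliesABC`, proved: the case `K = ℚ` of `NumberFieldABCConjecture`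
(`NumberFieldABCConjecture.abc_rat`) is the displayed sentence of `ABC` (`ABC_iff`).
[cite: GranvilleStark2000, §1 (opening sentence) with eq. (1)] -/
theorem numberFieldABC_imp_abc : NumberFieldABCConjecture → _root_.ABC :=
  fun h => ABC_iff.mpr (NumberFieldABCConjecture.abc_rat h)

/-- **F-1914: the `n`-conjecture for every `n ≥ 3` ⟹ abc** — the body of the registry's printed bridge
`Summit.ABC.StrongHypotheses.NConjectureAllImpliesABC`, proved: the case `n = 3` (`abcLe_of_nConjecture_three`) gives the
`≤`-form `c ≤ C · rad(abc)^{1+ε}`, and `abcLt_of_abcLe` the summit's strict form with `0 < C`.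
[cite: BrowkinBrzezinski1994, §1 (n = 3 is the abc-conjecture)] -/
theorem nConjectureAll_imp_abc : NConjectureAll → _root_.ABC :=
  fun h => ABC_iff.mpr (Literature.NumberTheory.EllipticCurves.abcLt_of_abcLe (abcLe_of_nConjecture_three (h 3 le_rfl)))

end Summit.ABC.IUTFork.F6
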